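import Mathlib
import Summits.Ventures.FusionMHD.Models.SAlphaStable58Core0
import HarnessLib

/-!
# STABLE-POINT core at `(1, 29/50)`, piece 1 (`[2, 4]`): kernel-decided Taylor-model leaves ⇒ `F_1 > 0` and `amplitudeResidual 1 (29/50) F_1 F_1″ ≤ 0` on the piece ⇒ `EnergyDominatesOn` for its amplitude phase

LADDER-GRIDFUSION rung F3 («F3.BALLOON-sα-STABLE-POINT-058»: the third point of the stable-side scan at unit shear, 5 % below the shot edge); gridfusion-model-7 g8, 2026-08-28.  Two `decide +kernel` calls (`OpModel.trig.pLeavesCheck`, scale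
`2^60`, Taylor degree 10, 16 leaves of half-width 1/16) and the lane's soundness theorem `OpSem.trig.pos_of_pLeavesCheck`
(Literature/Analysis/ValidatedNumerics/TaylorModelZeroCert); lit-4's `energyDominatesOn_of_amplitude` (BallooningSAlphaStableSide) turns the two
sign facts into energy domination by `amplitudePhase 1 (29/50) F_1 F_1′` on the piece.  MODELLED: `s–α` model; nothing about a device.
No `native_decide`.  Citations: Freidberg 2014 §12.6.2 (12.97) [Freidberg2014]; Makino–Berz 2003 Alg. 2 [MakinoBerz2003]; Hartman 2002 XI.6.2
[Hartman2002].  Everything here is [instance data].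
-/

open Literature.Analysis.ValidatedNumerics Literature.Analysis.ValidatedNumerics.PolyMP
open Literature.Analysis.ValidatedNumerics.NumericsMP Literature.Analysis.ValidatedNumerics.ExpPoly
open Literature.MathematicalPhysics.MHD.Ballooning
open Real Set

namespace Summit.Ventures.FusionMHD.Models

namespace SAlphaStable58

/-- KERNEL CHECK (residual leaves of piece 1). [instance data] -/
theorem e58_res1_ok : OpModel.trig.pLeavesCheck e58Prm (2 ^ 60) (e58Prog R1 (Poly.deriv (Poly.deriv R1))) [] e58Leaves1 = true := by
  decide +kernel

/-- KERNEL CHECK (positivity leaves of piece 1). [instance data] -/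
theorem e58_pos1_ok : OpModel.trig.pLeavesCheck e58Prm (2 ^ 60) (e58PosProg R1) [] e58Leaves1 = true := by
  decide +kernel

/-- The leaves tile `[2, 4]`. [instance data] -/
theorem e58_tiles1 : tiles (2 : ℚ) (e58Leaves1.map fun l => (l.e, l.k)) (4 : ℚ) = true := by
  decide +kernel

/-- **PIECE 1**: the phase of `F_1` dominates the `s–α` energy on `[2, 4]` at `(s, α) = (1, 29/50)`. [instance data] -/
theorem e58_dominates1 :
    SAlpha.EnergyDominatesOn 1 (29 / 50) (SAlpha.amplitudePhase 1 (29 / 50) (Poly.eval R1) (Poly.eval (Poly.deriv R1)))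
      (Icc (2 : ℝ) (4 : ℝ)) := by
  have h := e58_dominates (lf := R1) (x := 2) (y := 4) (by norm_num) e58_tiles1 e58_res1_ok e58_pos1_ok
  norm_num at h
  exact h

end SAlphaStable58

end Summit.Ventures.FusionMHD.Models
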